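import Summits.ABC.Analytic.RequirementsCongruence
import Literature.NumberTheory.EllipticCurves.CongruencePeriodTwistProductProofs
import Literature.NumberTheory.EllipticCurves.ManinConstantPlusPeriodCertificate
import Literature.NumberTheory.EllipticCurves.SkinnerUrban2014.PAdicUnitImaginaryPeriodRatioProofs
import Literature.NumberTheory.EllipticCurves.RohrlichNonvanishingProofs
import Literature.NumberTheory.EllipticCurves.ModularSymbolsHeckeProofs
import Literature.NumberTheory.EllipticCurves.PAdicLFunctionDistributionProofs
import Literature.NumberTheory.EllipticCurves.NewformsRealCoefficients
import Literature.NumberTheory.Automorphic.ShimuraCurveRibetTakahashiOptimalProofs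
import Literature.NumberTheory.Sieve.LargeSieveCharacters
import HarnessLib
import HarnessLib.Audit

/-!
# ABC — analytic / modular lens: the PERIOD SANDWICH and Birch's formula as period bounds (proof-only)

Cell `abc-an` (C1), seat `pr-1` (KEY PR-THMDOORS «theorem-shaped doors — period lower bounds», THMDOOR-1 as named
by the plan seat 2026-08-27T18:16Z). THEOREMS ONLY — no definitions, no named facts of its own; every statement is
proved from theorems of the tree, the two KNOWN named facts it uses (modularity `nonempty_modularParametrizationData`,
Mazur–Kenku `PastenShimura2024_minimalDegree_le_163_mul`) appearing as explicit hypotheses. The companion file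
`RequirementsPeriod` types the OPEN period rows (`PolyPeriodLowerBoundRat`, `PolyModSymRat`,
`TwistedCentralValueLowerBound`, …) and lands Goldfeld's dictionary «modular symbols ⇒ periods ⇒ height ⇒ A-PS» on
top of this file; `DegreeLowerBounds` holds the congruence-number / modular-degree lower bounds (THMDOOR-2).

HONESTY: abc is not proved by any of this; nothing in this file is conjectural — these are UNCONDITIONAL period
inequalities. The doors they serve give at best A-PS = `Summit.ABC.PolySzpiroRat`, which is **NOT abc — «NOT abc —
POLY-SZPIRO(E)»** (D-0139/D-0140).

## Contents
* §1 THE PERIOD SANDWICH (lower edge): for every globally minimal elliptic `W/ℚ` with newform `f` (datum at level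
  `N_W`), `Ω⁺_f · Ω⁻_f ≤ 652 · covol(Λ_W) = 326 · complexPeriod(W ⊗ ℂ)` modulo modularity + Mazur–Kenku
  (`periods_le_mul_covolume`, `periods_le_mul_complexPeriod`). Ingredients, all PROVED in the tree: the
  degree-optimal datum is lattice-optimal (`latticeEq_of_forall_modularDegree_le`, Knapp 12.9), `Ω(W₀) = |c₀| Ω⁺_f`
  (`realPeriodRat_eq_abs_mul_plusPeriod_of_latticeEq`), `m |Ω⁻(W₀)| = |c₀| Ω⁻_f`, `m ∣ 2`
  (`exists_dvd_two_mul_imaginaryPeriodRat_eq_of_latticeEq`), `Ω · |Ω⁻| = 2 covol` (Cremona §3.7), Zagier's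
  `4π² c² (f,f) = deg · covol` (`zagier_degree_formula_holds`) on `W₀` and on `W`, `c_W² ≥ 1`, `deg_W ≤ 163 deg_{W₀}`.
  The Manin constant enters with the HELPFUL sign in this direction: no Manin hypothesis (lens-5's `μ` is `0`).
* §2 BIRCH ⇒ PERIODS (Goldfeld 1990 (8) in the kernel): for a datum `Dt`, a primitive character `χ mod q` of given
  parity, the entire continuation `L` of `L(f ⊗ χ, s)` and a bound `M` on the normalised symbols `[a/q]^±`:
  `√q · |L(1)| ≤ q · M · Ω^±_f` (`sqrt_mul_norm_twistedL_le_plus` / `_minus`), from Birch `twisted_LValue_eq_holds`,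
  `|τ(χ̄)|² = q` (`norm_gaussSum_sq`), the parity split `twistedSymbolSum_eq_sum_plusSymbol` / `_minusSymbol` and
  `plusSymbol_eq_re_holds` / `minusSymbol_eq_im_mul_I_holds` (real newform) — all PROVED.

References: [Goldfeld1990ModularElliptic] §4 (4)–(8); [Birch1971]; [MazurTateTeitelbaum1986] §I.8 (8.6);
[CremonaAlgorithms1997] §2.8, §2.10, §3.7; [ZagierCMB1985] §1; [EdixhovenManin1991] Prop. 2; [Knapp1993] Prop. 12.9;
[Mazur1978]; [Kenku1982]; [PastenShimura2024] §3.
-/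

noncomputable section

open scoped MatrixGroups ModularForm Classical

namespace Summit.ABC.Analytic

open Literature.NumberTheory.EllipticCurves Literature.NumberTheory.EllipticCurves.ModularForms
open CongruenceSubgroup WeierstrassCurve

/-! ## §1 The period sandwich: `Ω⁺_f · Ω⁻_f ≤ 652 · covol(Λ_E)` (PROVED mod modularity + Mazur–Kenku) -/

section Sandwich
variable {N : ℕ} [NeZero N]

/-- **On the optimal curve the newform periods are dominated by the Néron covolume**: for a LATTICE-OPTIMAL datum
`D₀` of an elliptic `W₀/ℚ` (`Λ_{W₀} = c₀ Λ_f`): `c₀² · Ω⁺_f · Ω⁻_f ≤ 4 · covol(Λ_{D₀})`. From `Ω(W₀) = |c₀| Ω⁺_f`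
(`realPeriodRat_eq_abs_mul_plusPeriod_of_latticeEq`), `m · |Ω⁻(W₀)| = |c₀| Ω⁻_f` with `m ∣ 2`
(`exists_dvd_two_mul_imaginaryPeriodRat_eq_of_latticeEq`) and `Ω(W₀) · |Ω⁻(W₀)| = 2 covol(Λ_{D₀})`
(`realPeriodRat_mul_imaginaryPeriodRat_eq_two_mul_covolume`), all PROVED in the tree.
[cite: CremonaAlgorithms1997, §2.8 and §3.7] [cite: EdixhovenManin1991, Prop. 2] -/
theorem maninSq_mul_periods_le_four_mul_covolume_of_latticeEq {W₀ : WeierstrassCurve ℚ} [W₀.IsElliptic]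
    (D₀ : ModularParametrizationData W₀ N)
    (hopt : ∀ z ∈ D₀.L.lattice, ∃ w ∈ periodLattice D₀.f, z = D₀.c * w) :
    (D₀.c : ℝ) ^ 2 * (plusPeriod D₀.f * minusPeriod D₀.f) ≤ 4 * ZLattice.covolume D₀.L.lattice := by
  have hplus : 0 < plusPeriod D₀.f := D₀.plusPeriod_newform_pos
  have hminus : 0 < minusPeriod D₀.f :=
    IsNewform0.minusPeriod_pos_holds D₀.isNewformOf.1 D₀.isNewformOf.coeffField_eq_bot
  have hre : W₀.realPeriodRat = |(D₀.c : ℝ)| * plusPeriod D₀.f :=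
    D₀.realPeriodRat_eq_abs_mul_plusPeriod_of_latticeEq hopt
  obtain ⟨m, hm2, him⟩ :=
    Literature.NumberTheory.EllipticCurves.SkinnerUrban2014.exists_dvd_two_mul_imaginaryPeriodRat_eq_of_latticeEq
      D₀ hopt
  have hcov : W₀.realPeriodRat * W₀.imaginaryPeriodRat = 2 * ZLattice.covolume D₀.L.lattice :=
    D₀.realPeriodRat_mul_imaginaryPeriodRat_eq_two_mul_covolume
  have hm_le : (m : ℝ) ≤ 2 := by exact_mod_cast Nat.le_of_dvd two_pos hm2
  have himpos : 0 < W₀.imaginaryPeriodRat := W₀.imaginaryPeriodRat_pos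
  have habs : 0 ≤ |(D₀.c : ℝ)| := abs_nonneg _
  -- `|c₀| Ω⁻_f = m |Ω⁻| ≤ 2 |Ω⁻|`
  have h1 : |(D₀.c : ℝ)| * minusPeriod D₀.f ≤ 2 * W₀.imaginaryPeriodRat := by
    rw [← him]; exact mul_le_mul_of_nonneg_right hm_le himpos.le
  -- multiply by `Ω(W₀) = |c₀| Ω⁺_f ≥ 0`
  have h2 : (|(D₀.c : ℝ)| * plusPeriod D₀.f) * (|(D₀.c : ℝ)| * minusPeriod D₀.f) ≤
      (|(D₀.c : ℝ)| * plusPeriod D₀.f) * (2 * W₀.imaginaryPeriodRat) :=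
    mul_le_mul_of_nonneg_left h1 (by positivity)
  rw [← hre] at h2
  have h3 : W₀.realPeriodRat * (2 * W₀.imaginaryPeriodRat) = 4 * ZLattice.covolume D₀.L.lattice := by
    rw [mul_left_comm, hcov]; ring
  rw [h3, hre] at h2
  have hsqabs : (D₀.c : ℝ) ^ 2 = |(D₀.c : ℝ)| ^ 2 := (sq_abs _).symm
  have hEq : (D₀.c : ℝ) ^ 2 * (plusPeriod D₀.f * minusPeriod D₀.f)
      = (|(D₀.c : ℝ)| * plusPeriod D₀.f) * (|(D₀.c : ℝ)| * minusPeriod D₀.f) := by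
    rw [hsqabs]; ring
  rw [hEq]
  exact h2

/-- **Zagier twice: the Néron covolume of any member against the optimal one.** For data `D` of `W` and `D₀` of `W₀`
at one level with the same newform and `deg D ≤ 163 · deg D₀`:
`c_W² · covol(Λ_{D₀}) ≤ 163 · c₀² · covol(Λ_D)` — from `4π² c² (f,f) = deg · covol` for both data (PROVED
`zagier_degree_formula_holds`). [cite: ZagierCMB1985, §1 (p. 374)] [cite: PastenShimura2024, §3 p. 13] -/
theorem maninSq_mul_covolume_le_of_deg_le {W W₀ : WeierstrassCurve ℚ} [W.IsElliptic] [W₀.IsElliptic]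
    (D : ModularParametrizationData W N) (D₀ : ModularParametrizationData W₀ N) (hf : D.f = D₀.f)
    (hdeg : D.modularDegree ≤ 163 * D₀.modularDegree) :
    (D.c : ℝ) ^ 2 * ZLattice.covolume D₀.L.lattice ≤ 163 * (D₀.c : ℝ) ^ 2 * ZLattice.covolume D.L.lattice := by
  have hZ := congrArg Complex.re D.zagier_degree_formula_holds
  have hZ₀ := congrArg Complex.re D₀.zagier_degree_formula_holds
  rw [Complex.re_ofReal_mul, Complex.ofReal_re] at hZ hZ₀
  rw [hf] at hZ
  -- `hZ : 4π² c² P = deg D · covol D`, `hZ₀ : 4π² c₀² P = deg D₀ · covol D₀`, same `P = Re (f,f)`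
  set P := (peterssonProduct (Gamma0 N) 2 D₀.f D₀.f).re with hP
  have hPpos : 0 < P := D₀.zagier_degree_formula_holds.peterssonProduct_re_pos
  have hcov : 0 < ZLattice.covolume D.L.lattice := ZLattice.covolume_pos _ _
  have hcov₀ : 0 < ZLattice.covolume D₀.L.lattice := ZLattice.covolume_pos _ _
  have hdegR : (D.deg : ℝ) ≤ 163 * (D₀.deg : ℝ) := by
    have h : D.deg ≤ 163 * D₀.deg := hdeg
    exact_mod_cast h
  have hπ : (0 : ℝ) < 4 * Real.pi ^ 2 := by positivity
  -- `c² covol₀ · (4π² P) = covol₀ · deg · covol / ... `: multiply out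
  have key : (D.c : ℝ) ^ 2 * ZLattice.covolume D₀.L.lattice * (D₀.deg * ZLattice.covolume D₀.L.lattice) ≤
      163 * (D₀.c : ℝ) ^ 2 * ZLattice.covolume D.L.lattice * (D₀.deg * ZLattice.covolume D₀.L.lattice) := by
    calc (D.c : ℝ) ^ 2 * ZLattice.covolume D₀.L.lattice * (D₀.deg * ZLattice.covolume D₀.L.lattice)
        = ZLattice.covolume D₀.L.lattice * (D₀.c : ℝ) ^ 2 * (4 * Real.pi ^ 2 * (D.c : ℝ) ^ 2 * P) := by
          rw [← hZ₀]; ring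
      _ = ZLattice.covolume D₀.L.lattice * (D₀.c : ℝ) ^ 2 * (D.deg * ZLattice.covolume D.L.lattice) := by
          rw [hZ]
      _ ≤ ZLattice.covolume D₀.L.lattice * (D₀.c : ℝ) ^ 2 * (163 * D₀.deg * ZLattice.covolume D.L.lattice) := by
          have h1 : (D.deg : ℝ) * ZLattice.covolume D.L.lattice ≤ 163 * D₀.deg * ZLattice.covolume D.L.lattice :=
            mul_le_mul_of_nonneg_right hdegR hcov.le
          exact mul_le_mul_of_nonneg_left h1 (mul_nonneg hcov₀.le (sq_nonneg _))
      _ = 163 * (D₀.c : ℝ) ^ 2 * ZLattice.covolume D.L.lattice * (D₀.deg * ZLattice.covolume D₀.L.lattice) := by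
          ring
  have hd₀ : (0 : ℝ) < D₀.deg * ZLattice.covolume D₀.L.lattice := by
    have : (0 : ℝ) < D₀.deg := by exact_mod_cast D₀.deg_pos
    positivity
  exact le_of_mul_le_mul_right key hd₀

/-- **THE PERIOD SANDWICH (lower edge)**, modulo the KNOWN named facts modularity (`hmod`, BCDT) and Mazur–Kenku
(`h163`): for every globally minimal elliptic `W/ℚ` and every datum `D` at level `N_W`,
`Ω⁺_f · Ω⁻_f ≤ 652 · covol(Λ_W) = 326 · complexPeriod(W ⊗ ℂ)` (`f = D.f` the newform of `W`; `652 = 4·163`).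
Proof: the minimal-degree datum `D_W` of `W` and the degree-optimal datum `D₀` of the class (which is lattice-optimal,
`latticeEq_of_forall_modularDegree_le`) share the newform; `deg D_W ≤ 163 deg D₀` (Mazur–Kenku);
`c₀² Ω⁺Ω⁻ ≤ 4 covol₀` and `c_W² covol₀ ≤ 163 c₀² covol_W` with `c_W² ≥ 1`. An UNCONDITIONAL period inequality of
the tree modulo two named known facts; the Manin constant needs no bound in this direction.
[cite: Goldfeld1990ModularElliptic, §4] [cite: ZagierCMB1985, §1] [cite: Kenku1982] -/
theorem periods_le_mul_covolume (hmod : nonempty_modularParametrizationData)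
    (h163 : PastenShimura2024_minimalDegree_le_163_mul)
    (W : WeierstrassCurve ℚ) [W.IsElliptic] [W.IsGloballyMinimal] [NeZero (W.conductorNorm ℤ)]
    (D : ModularParametrizationData W (W.conductorNorm ℤ)) :
    plusPeriod D.f * minusPeriod D.f ≤ 652 * ZLattice.covolume D.L.lattice := by
  obtain ⟨DW, -, hDW⟩ := exists_minimal_datum (hmod W)
  obtain ⟨W₀, _, D₀, hf, hopt⟩ := Pasten2024.exists_minimal_datum_in_class DW
  have hlat : ∀ z ∈ D₀.L.lattice, ∃ w ∈ periodLattice D₀.f, z = D₀.c * w :=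
    D₀.latticeEq_of_forall_modularDegree_le hopt
  have h163' : DW.modularDegree ≤ 163 * D₀.modularDegree := h163 _ W₀ W D₀ DW hf.symm hopt hDW
  have hA := maninSq_mul_periods_le_four_mul_covolume_of_latticeEq D₀ hlat
  have hB := maninSq_mul_covolume_le_of_deg_le DW D₀ hf.symm h163'
  -- the newform and the lattice do not depend on the datum of `W`
  have hfD : D.f = D₀.f := (D.isNewformOf.unique DW.isNewformOf).trans hf.symm
  have hcovD : ZLattice.covolume D.L.lattice = ZLattice.covolume DW.L.lattice := by
    have h1 := D.two_mul_covolume_eq_complexPeriod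
    have h2 := DW.two_mul_covolume_eq_complexPeriod
    linarith
  rw [hfD, hcovD]
  have hcW : (1 : ℝ) ≤ (DW.c : ℝ) ^ 2 := by
    have h0 : DW.c ≠ 0 := DW.maninConstant_ne_zero_holds
    have h1 : (1 : ℤ) ≤ DW.c ^ 2 := by nlinarith [Int.one_le_abs h0, sq_abs DW.c]
    exact_mod_cast h1
  have hcov₀ : 0 < ZLattice.covolume D₀.L.lattice := ZLattice.covolume_pos _ _
  have hcovW : 0 < ZLattice.covolume DW.L.lattice := ZLattice.covolume_pos _ _
  have hper : 0 ≤ plusPeriod D₀.f * minusPeriod D₀.f :=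
    mul_nonneg D₀.plusPeriod_newform_pos.le
      (IsNewform0.minusPeriod_pos_holds D₀.isNewformOf.1 D₀.isNewformOf.coeffField_eq_bot).le
  -- `c₀² ΩΩ ≤ 4 covol₀ ≤ 4 c_W² covol₀ ≤ 4·163 c₀² covol_W`, divide by `c₀² ≥ 1`
  have hc₀ : (0 : ℝ) < (D₀.c : ℝ) ^ 2 := by
    have h0 : D₀.c ≠ 0 := D₀.maninConstant_ne_zero_holds
    have : (D₀.c : ℝ) ≠ 0 := by exact_mod_cast h0
    positivity
  have key : (D₀.c : ℝ) ^ 2 * (plusPeriod D₀.f * minusPeriod D₀.f) ≤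
      (D₀.c : ℝ) ^ 2 * (652 * ZLattice.covolume DW.L.lattice) := by
    have h4 : ZLattice.covolume D₀.L.lattice ≤ (DW.c : ℝ) ^ 2 * ZLattice.covolume D₀.L.lattice := by
      calc ZLattice.covolume D₀.L.lattice = 1 * ZLattice.covolume D₀.L.lattice := (one_mul _).symm
        _ ≤ (DW.c : ℝ) ^ 2 * ZLattice.covolume D₀.L.lattice := mul_le_mul_of_nonneg_right hcW hcov₀.le
    have h5 : (D₀.c : ℝ) ^ 2 * (plusPeriod D₀.f * minusPeriod D₀.f) ≤
        4 * (163 * (D₀.c : ℝ) ^ 2 * ZLattice.covolume DW.L.lattice) :=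
      calc (D₀.c : ℝ) ^ 2 * (plusPeriod D₀.f * minusPeriod D₀.f) ≤ 4 * ZLattice.covolume D₀.L.lattice := hA
        _ ≤ 4 * ((DW.c : ℝ) ^ 2 * ZLattice.covolume D₀.L.lattice) :=
            mul_le_mul_of_nonneg_left h4 (by norm_num)
        _ ≤ 4 * (163 * (D₀.c : ℝ) ^ 2 * ZLattice.covolume DW.L.lattice) :=
            mul_le_mul_of_nonneg_left hB (by norm_num)
    have h6 : 4 * (163 * (D₀.c : ℝ) ^ 2 * ZLattice.covolume DW.L.lattice) =
        (D₀.c : ℝ) ^ 2 * (652 * ZLattice.covolume DW.L.lattice) := by ring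
    linarith [h5, h6]
  exact le_of_mul_le_mul_left key hc₀

/-- **Curve form of the sandwich**: for every globally minimal elliptic `W/ℚ` and datum `D` at level `N_W`,
`Ω⁺_f · Ω⁻_f ≤ 326 · complexPeriod(W ⊗ ℂ)` (`2 covol(Λ_D) = complexPeriod`, `two_mul_covolume_eq_complexPeriod`).
[cite: CremonaAlgorithms1997, §3.7] [cite: ZagierCMB1985, §1] -/
theorem periods_le_mul_complexPeriod (hmod : nonempty_modularParametrizationData)
    (h163 : PastenShimura2024_minimalDegree_le_163_mul)
    (W : WeierstrassCurve ℚ) [W.IsElliptic] [W.IsGloballyMinimal] [NeZero (W.conductorNorm ℤ)]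
    (D : ModularParametrizationData W (W.conductorNorm ℤ)) :
    plusPeriod D.f * minusPeriod D.f ≤ 326 * (W.baseChange ℂ).complexPeriod := by
  have h := periods_le_mul_covolume hmod h163 W D
  have h2 := D.two_mul_covolume_eq_complexPeriod
  linarith

end Sandwich

/-! ## §2 Birch's formula + a symbol bound ⇒ a period lower bound (the unconditional half of Goldfeld's dictionary) -/

section Birch
variable {N : ℕ} [NeZero N] {W : WeierstrassCurve ℚ}

/-- **Birch + symbol bound ⇒ real-period lower bound.** For a datum `Dt`, a prime... (any modulus `q ≥ 1`), a
PRIMITIVE EVEN character `χ mod q`, the entire continuation `L` of `L(f ⊗ χ, s)` and a bound `M` for the normalised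
plus symbols `|[a/q]⁺| ≤ M` (`a ∈ ℤ`): `√q · |L(1)| ≤ q · M · Ω⁺_f`. Birch `τ(χ̄) L(f,χ,1) = Σ_a χ̄(a){∞,a/q}`
(PROVED `twisted_LValue_eq_holds`), `|τ(χ̄)|² = q` (PROVED `norm_gaussSum_sq`), even parity
`Σ_a χ̄(a){∞,a/q} = Σ_a χ̄(a)·plusSymbol(a/q)` (PROVED), `plusSymbol = re{∞,·} = [·]⁺ Ω⁺` (real newform, PROVED).
[cite: Birch1971] [cite: MazurTateTeitelbaum1986, §I.8 (8.6)] [cite: Goldfeld1990ModularElliptic, §4 (8)] -/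
theorem sqrt_mul_norm_twistedL_le_plus [W.IsElliptic] (Dt : ModularParametrizationData W N) {q : ℕ} [NeZero q]
    {χ : DirichletCharacter ℂ q} (hχ : χ.IsPrimitive) (heven : χ (-1) = 1) {L : ℂ → ℂ}
    (hL : Differentiable ℂ L) (hL' : ∀ s : ℂ, 2 < s.re → L s = twistedLSeries Dt.f χ s) {M : ℝ}
    (hM : ∀ a : ℤ, |normalizedPlusSymbol Dt.f ((a : ℚ) / q)| ≤ M) :
    Real.sqrt q * ‖L 1‖ ≤ q * M * plusPeriod Dt.f := by
  have hplus : 0 < plusPeriod Dt.f := Dt.plusPeriod_newform_pos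
  have hreal : ∀ n, (cuspCoeff Dt.f n).im = 0 := Dt.isNewformOf.1.cuspCoeff_im_eq_zero
  -- Birch's formula
  have hB : gaussSum χ⁻¹ (ZMod.stdAddChar (N := q)) * L 1 = twistedSymbolSum Dt.f χ⁻¹ :=
    twisted_LValue_eq_holds Dt.f hχ hL hL'
  -- Gauss sum of the primitive `χ⁻¹`
  have hτ : ‖gaussSum χ⁻¹ (ZMod.stdAddChar (N := q))‖ = Real.sqrt q := by
    rw [← Real.sqrt_sq (norm_nonneg _),
      Literature.NumberTheory.Sieve.LargeSieve.norm_gaussSum_sq (isPrimitive_inv hχ)]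
  -- even parity of `χ⁻¹`
  have heven' : χ⁻¹ (-1) = 1 := by
    rw [MulChar.inv_apply_eq_inv', heven, inv_one]
  have hsum : twistedSymbolSum Dt.f χ⁻¹ =
      ∑ a : ZMod q, χ⁻¹ a * plusSymbol Dt.f ((a.val : ℚ) / q) :=
    twistedSymbolSum_eq_sum_plusSymbol heven'
  -- each term: `‖χ⁻¹ a · plusSymbol(a/q)‖ ≤ M Ω⁺`
  have hterm : ∀ a : ZMod q, ‖χ⁻¹ a * plusSymbol Dt.f ((a.val : ℚ) / q)‖ ≤ M * plusPeriod Dt.f := by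
    intro a
    have hps : plusSymbol Dt.f ((a.val : ℚ) / q) =
        ((normalizedPlusSymbol Dt.f ((a.val : ℚ) / q) * plusPeriod Dt.f : ℝ) : ℂ) := by
      rw [plusSymbol_eq_re_holds Dt.f hreal, normalizedPlusSymbol, div_mul_cancel₀ _ hplus.ne']
      rw [plusSymbol_eq_re_holds Dt.f hreal, Complex.ofReal_re]
    rw [norm_mul, hps, Complex.norm_real, Real.norm_eq_abs, abs_mul, abs_of_pos hplus]
    have hχle : ‖χ⁻¹ a‖ ≤ 1 := DirichletCharacter.norm_le_one χ⁻¹ a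
    have hMa : |normalizedPlusSymbol Dt.f ((a.val : ℚ) / q)| ≤ M := by
      have := hM (a.val : ℤ)
      rwa [Int.cast_natCast] at this
    have hM0 : 0 ≤ M := (abs_nonneg _).trans hMa
    calc ‖χ⁻¹ a‖ * (|normalizedPlusSymbol Dt.f ((a.val : ℚ) / q)| * plusPeriod Dt.f)
        ≤ 1 * (M * plusPeriod Dt.f) :=
          mul_le_mul hχle (mul_le_mul_of_nonneg_right hMa hplus.le) (by positivity) zero_le_one
      _ = M * plusPeriod Dt.f := one_mul _
  have hnorm : ‖twistedSymbolSum Dt.f χ⁻¹‖ ≤ q * (M * plusPeriod Dt.f) := by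
    rw [hsum]
    calc ‖∑ a : ZMod q, χ⁻¹ a * plusSymbol Dt.f ((a.val : ℚ) / q)‖
        ≤ ∑ a : ZMod q, ‖χ⁻¹ a * plusSymbol Dt.f ((a.val : ℚ) / q)‖ := norm_sum_le _ _
      _ ≤ ∑ _a : ZMod q, M * plusPeriod Dt.f := Finset.sum_le_sum fun a _ => hterm a
      _ = q * (M * plusPeriod Dt.f) := by
          rw [Finset.sum_const, Finset.card_univ, ZMod.card, nsmul_eq_mul]
  calc Real.sqrt q * ‖L 1‖ = ‖gaussSum χ⁻¹ (ZMod.stdAddChar (N := q)) * L 1‖ := by rw [norm_mul, hτ]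
    _ = ‖twistedSymbolSum Dt.f χ⁻¹‖ := by rw [hB]
    _ ≤ q * M * plusPeriod Dt.f := by rw [mul_assoc]; exact hnorm

/-- **Birch + symbol bound ⇒ imaginary-period lower bound** (odd characters; `minusSymbol = i·im{∞,·} = i [·]⁻ Ω⁻`):
`√q · |L(1)| ≤ q · M · Ω⁻_f`. [cite: Birch1971] [cite: Goldfeld1990ModularElliptic, §4 (8) "χ(−1) = −1 … G(χ)L_f(1,χ) ∈ ℤ·Ω₂"] -/
theorem sqrt_mul_norm_twistedL_le_minus [W.IsElliptic] (Dt : ModularParametrizationData W N) {q : ℕ} [NeZero q]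
    {χ : DirichletCharacter ℂ q} (hχ : χ.IsPrimitive) (hodd : χ (-1) = -1) {L : ℂ → ℂ}
    (hL : Differentiable ℂ L) (hL' : ∀ s : ℂ, 2 < s.re → L s = twistedLSeries Dt.f χ s) {M : ℝ}
    (hM : ∀ a : ℤ, |normalizedMinusSymbol Dt.f ((a : ℚ) / q)| ≤ M) :
    Real.sqrt q * ‖L 1‖ ≤ q * M * minusPeriod Dt.f := by
  have hminus : 0 < minusPeriod Dt.f :=
    IsNewform0.minusPeriod_pos_holds Dt.isNewformOf.1 Dt.isNewformOf.coeffField_eq_bot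
  have hreal : ∀ n, (cuspCoeff Dt.f n).im = 0 := Dt.isNewformOf.1.cuspCoeff_im_eq_zero
  have hB : gaussSum χ⁻¹ (ZMod.stdAddChar (N := q)) * L 1 = twistedSymbolSum Dt.f χ⁻¹ :=
    twisted_LValue_eq_holds Dt.f hχ hL hL'
  have hτ : ‖gaussSum χ⁻¹ (ZMod.stdAddChar (N := q))‖ = Real.sqrt q := by
    rw [← Real.sqrt_sq (norm_nonneg _),
      Literature.NumberTheory.Sieve.LargeSieve.norm_gaussSum_sq (isPrimitive_inv hχ)]
  have hodd' : χ⁻¹ (-1) = -1 := by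
    rw [MulChar.inv_apply_eq_inv', hodd, inv_neg_one]
  have hsum : twistedSymbolSum Dt.f χ⁻¹ =
      ∑ a : ZMod q, χ⁻¹ a * minusSymbol Dt.f ((a.val : ℚ) / q) :=
    twistedSymbolSum_eq_sum_minusSymbol hodd'
  have hterm : ∀ a : ZMod q, ‖χ⁻¹ a * minusSymbol Dt.f ((a.val : ℚ) / q)‖ ≤ M * minusPeriod Dt.f := by
    intro a
    have hms : minusSymbol Dt.f ((a.val : ℚ) / q) =
        ((normalizedMinusSymbol Dt.f ((a.val : ℚ) / q) * minusPeriod Dt.f : ℝ) : ℂ) * Complex.I := by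
      rw [normalizedMinusSymbol, div_mul_cancel₀ _ hminus.ne']
      rw [minusSymbol_eq_im_mul_I_holds Dt.f hreal]
      simp
    rw [norm_mul, hms, norm_mul, Complex.norm_I, mul_one, Complex.norm_real, Real.norm_eq_abs, abs_mul,
      abs_of_pos hminus]
    have hχle : ‖χ⁻¹ a‖ ≤ 1 := DirichletCharacter.norm_le_one χ⁻¹ a
    have hMa : |normalizedMinusSymbol Dt.f ((a.val : ℚ) / q)| ≤ M := by
      have := hM (a.val : ℤ)
      rwa [Int.cast_natCast] at this
    calc ‖χ⁻¹ a‖ * (|normalizedMinusSymbol Dt.f ((a.val : ℚ) / q)| * minusPeriod Dt.f)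
        ≤ 1 * (M * minusPeriod Dt.f) :=
          mul_le_mul hχle (mul_le_mul_of_nonneg_right hMa hminus.le) (by positivity) zero_le_one
      _ = M * minusPeriod Dt.f := one_mul _
  have hnorm : ‖twistedSymbolSum Dt.f χ⁻¹‖ ≤ q * (M * minusPeriod Dt.f) := by
    rw [hsum]
    calc ‖∑ a : ZMod q, χ⁻¹ a * minusSymbol Dt.f ((a.val : ℚ) / q)‖
        ≤ ∑ a : ZMod q, ‖χ⁻¹ a * minusSymbol Dt.f ((a.val : ℚ) / q)‖ := norm_sum_le _ _
      _ ≤ ∑ _a : ZMod q, M * minusPeriod Dt.f := Finset.sum_le_sum fun a _ => hterm a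
      _ = q * (M * minusPeriod Dt.f) := by
          rw [Finset.sum_const, Finset.card_univ, ZMod.card, nsmul_eq_mul]
  calc Real.sqrt q * ‖L 1‖ = ‖gaussSum χ⁻¹ (ZMod.stdAddChar (N := q)) * L 1‖ := by rw [norm_mul, hτ]
    _ = ‖twistedSymbolSum Dt.f χ⁻¹‖ := by rw [hB]
    _ ≤ q * M * minusPeriod Dt.f := by rw [mul_assoc]; exact hnorm

/-- Arithmetic of the dictionary: from `√q · ℓ ≤ q · M · Ω` with `q ≤ Q`, `0 < q`, `0 ≤ M`, `0 ≤ ℓ`: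
`ℓ ≤ √Q · M · Ω`. [folklore] -/
theorem le_sqrt_mul_of_sqrt_mul_le {q Q M Ω ℓ : ℝ} (hq : 0 < q) (hqQ : q ≤ Q) (hM : 0 ≤ M) (hΩ : 0 ≤ Ω)
    (h : Real.sqrt q * ℓ ≤ q * M * Ω) : ℓ ≤ Real.sqrt Q * M * Ω := by
  have hsq : 0 < Real.sqrt q := Real.sqrt_pos.mpr hq
  have hqq : Real.sqrt q * (Real.sqrt q * M * Ω) = q * M * Ω := by
    rw [show Real.sqrt q * (Real.sqrt q * M * Ω) = (Real.sqrt q * Real.sqrt q) * M * Ω by ring,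
      Real.mul_self_sqrt hq.le]
  have h1 : Real.sqrt q * ℓ ≤ Real.sqrt q * (Real.sqrt q * M * Ω) := by
    rw [hqq]; exact h
  have h2 : ℓ ≤ Real.sqrt q * M * Ω := le_of_mul_le_mul_left h1 hsq
  have h3 : Real.sqrt q ≤ Real.sqrt Q := Real.sqrt_le_sqrt hqQ
  calc ℓ ≤ Real.sqrt q * M * Ω := h2
    _ ≤ Real.sqrt Q * M * Ω := by
        apply mul_le_mul_of_nonneg_right _ hΩ
        exact mul_le_mul_of_nonneg_right h3 hM

end Birch

end Summit.ABC.Analytic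

end
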